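import Literature.NumberTheory.Sieve.GoldstonYildirimLemma21
import Literature.NumberTheory.Sieve.GreenTao2008SharpGYDiagonal
import Literature.NumberTheory.LFunctions.MoebiusLogHarmonicSum
import HarnessLib

/-!
# Goldston–Yıldırım I, Lemma 2.1, (2.13) at `j = 0` (the truncated Möbius sum) — PROOF

Topic `Literature/NumberTheory/Sieve`. Everything in this file is PROVED. It discharges the named
fact `Literature.NumberTheory.Sieve.goldstonYildirim_lemma21_j0` of `GoldstonYildirimLemma21.lean`
(D. A. Goldston, C. Y. Yıldırım, *Higher correlations of divisor sums related to primes I: triple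
correlations*, Integers 3 (2003) A5 = arXiv:math/0111212, Lemma 2.1, eq. (2.13) with `j = 0`,
p. 13): there is an absolute `c > 0` such that for every `B > 0` there is `C` with

  `|∑_{d ≤ R, (d,k)=1} μ(d)/d| ≤ C exp(-c √log R)`  for all `k ≥ 1`, `R ≥ 1`, `k ≤ R^B`

(`goldstonYildirim_lemma21_j0_holds`). The sibling `GoldstonYildirimLemma21Proofs.lean` proves the
log-weighted evaluation (2.11)–(2.12) at `j = 0` (`goldstonYildirim_lemma21_log_j0_holds`) by a
parallel elementary route (`CoprimeMoebius.fCop`, Euler products over `Nat.factoredNumbers`); the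
present file is independent of it and rides on the `GreenTao2008.SharpGY` Rankin machinery instead.

## The printed proof and the road taken here

GY (pp. 15–18) write the generating Dirichlet series as
`F(s) = ∑_{(n,k)=1} μ(n) n^{-1-s} = ζ(s+1)⁻¹ g_k(s)`, `g_k(s) = ∏_{p ∣ k} (1 - p^{-1-s})⁻¹`
(their (3.1) at `j = 0`, where `h_k ≡ 1`), apply Perron's formula with `T = exp(√log R)`, move the
contour into the classical zero-free region and bound `|g_k(s)| ≪ exp(4 √log k)` there ((3.5)).
We follow the SAME factorisation but read it on the coefficient side, which is the shorter road
given what the tree already proves: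

* `F = ζ(s+1)⁻¹ · g_k` is the convolution identity `μ·𝟙_{(·,k)=1} = 𝟙_{rad ∣ k} * μ` (the tree's
  `GreenTao2008.SharpGY.radInd_mul_moebius`), whence, by Dirichlet's rearrangement,
  `∑_{d ≤ R, (d,k)=1} μ(d)/d = ∑_{m ≤ R, rad m ∣ k} m(R/m)/m` with `m(y) = ∑_{e ≤ y} μ(e)/e`
  (`sum_coprime_moebius_div_eq_sum`);
* the zero-free region enters only through the tree's PROVED de la Vallée-Poussin bound
  `m(y) ≪ exp(-c₀ √log y)`
  (`Literature.NumberTheory.LFunctions.abs_sum_moebius_div_le_exp_neg_sqrt_log`, Landau;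
  Montgomery–Vaughan §8.1), used for `m ≤ √R` (where `log(R/m) ≥ (log R)/2`) together with
  `∑_{m ≤ R} 1/m ≤ 1 + log R`;
* the factor `g_k` is handled, as GY's (3.5) is, by a Rankin bound: on the tail `m > √R` one has
  `|m(y)| ≤ C₁` and `∑_{√R < m ≤ R, rad m ∣ k} 1/m ≤ R^{-1/4} Π_k(1/2)`,
  `Π_k(1/2) = ∏_{p ∣ k} (1 - p^{-1/2})⁻¹ ≤ 5^{Z+1} exp(4 ω(k)/√Z)` (the tree's
  `sum_radInd_div_Ioc_le`, `rankinProd_half_le`); with `Z = ⌊log R/32⌋ + 1` and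
  `ω(k) ≤ 2 log k ≤ 2 B log R` this is `≤ e⁴ R^{1/16} exp(48 B √log R)`, which the power saving
  `R^{-1/4}` absorbs for EVERY `B` (`rankinProd_half_le_of_le_rpow`).

Hence `c = c₀/4` is absolute (independent of `B`) while `C` depends on `B` — exactly the
quantifier order `∃ c, ∀ B, ∃ C` of the vendored statement.

## References

* D. A. Goldston, C. Y. Yıldırım, Integers 3 (2003), A5 = arXiv:math/0111212 — Lemma 2.1 (2.13),
  proof pp. 15–18, eqs. (3.1), (3.5). [GoldstonYildirim2001]
* H. L. Montgomery, R. C. Vaughan, *Multiplicative Number Theory I*, CUP 2007, §8.1.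
  [MontgomeryVaughan2007]
-/

noncomputable section

open Finset Real
open scoped ArithmeticFunction.Moebius

namespace Literature.NumberTheory.Sieve

open Literature.NumberTheory.Sieve.GreenTao2008.SharpGY
open Literature.NumberTheory.Sieve.SquarefreeSums (copInd copInd_apply
  sum_Icc_sum_divisorsAntidiagonal)
open Literature.NumberTheory.LFunctions (abs_sum_moebius_div_le_exp_neg_sqrt_log)
open Literature.NumberTheory.LFunctions.MoebiusLogSum (log_mul_exp_neg_mul_sqrt_le)

namespace GoldstonYildirimLemma21

/-- **`∑_{a ≤ y, (a,q)=1} μ(a)/a = ∑_{m ≤ y, rad m ∣ q} m(y/m)/m`** with `m(z) = ∑_{e ≤ z} μ(e)/e`: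
the coefficient form of GY's factorisation `F(s) = ζ(s+1)⁻¹ g_k(s)` ((3.1) at `j = 0`), i.e. the
convolution identity `μ·𝟙_{(·,q)=1} = 𝟙_{rad ∣ q} * μ` followed by Dirichlet's rearrangement
`∑_{n ≤ Y} ∑_{ma = n} = ∑_{m ≤ Y} ∑_{a ≤ Y/m}`.
[cite: GoldstonYildirim2001, proof of Lemma 2.1, eq. (3.1)] -/
theorem sum_coprime_moebius_div_eq_sum {q : ℕ} (hq : q ≠ 0) (y : ℝ) :
    ∑ a ∈ (Icc 1 ⌊y⌋₊).filter (fun a => a.Coprime q), (μ a : ℝ) / a =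
      ∑ m ∈ (Icc 1 ⌊y⌋₊).filter (fun m => m.primeFactors ⊆ q.primeFactors),
        (∑ e ∈ Icc 1 ⌊y / m⌋₊, (μ e : ℝ) / e) / m := by
  set Y := ⌊y⌋₊ with hY
  set F : ℕ → ℕ → ℝ := fun m a => radInd q m * (μ a : ℝ) * (1 / ((m * a : ℕ) : ℝ)) with hF
  have hrhs : ∑ m ∈ (Icc 1 Y).filter (fun m => m.primeFactors ⊆ q.primeFactors),
      (∑ e ∈ Icc 1 ⌊y / m⌋₊, (μ e : ℝ) / e) / m = ∑ m ∈ Icc 1 Y, ∑ a ∈ Icc 1 (Y / m), F m a := by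
    rw [Finset.sum_filter]
    refine Finset.sum_congr rfl fun m hm => ?_
    have hm1 : 1 ≤ m := (mem_Icc.1 hm).1
    have hm0 : (m : ℝ) ≠ 0 := by exact_mod_cast (show m ≠ 0 by omega)
    have hfl : ⌊y / m⌋₊ = Y / m := by rw [hY, Nat.floor_div_natCast]
    split_ifs with hsub
    · have hind : radInd q m = 1 := by rw [radInd_apply, if_pos ⟨by omega, hsub⟩]
      rw [hfl, Finset.sum_div]
      refine Finset.sum_congr rfl fun a ha => ?_
      have ha0 : (a : ℝ) ≠ 0 := by exact_mod_cast (show a ≠ 0 by have := (mem_Icc.1 ha).1; omega)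
      simp only [hF, hind, one_mul]
      push_cast
      field_simp
    · have hind : radInd q m = 0 := by rw [radInd_apply, if_neg (fun h => hsub h.2)]
      symm
      exact Finset.sum_eq_zero fun a _ => by simp [hF, hind]
  rw [hrhs, ← sum_Icc_sum_divisorsAntidiagonal F Y, Finset.sum_filter]
  refine Finset.sum_congr rfl fun n hn => ?_
  have hn1 : 1 ≤ n := (mem_Icc.1 hn).1
  have hconv := congrArg (fun f : ArithmeticFunction ℝ => f n) (radInd_mul_moebius hq)
  simp only [ArithmeticFunction.mul_apply, ArithmeticFunction.pmul_apply,
    ArithmeticFunction.intCoe_apply] at hconv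
  have hinner : ∑ x ∈ n.divisorsAntidiagonal, F x.1 x.2 =
      (∑ x ∈ n.divisorsAntidiagonal, radInd q x.1 * (μ x.2 : ℝ)) * (1 / (n : ℝ)) := by
    rw [Finset.sum_mul]
    refine Finset.sum_congr rfl fun x hx => ?_
    have hxn : x.1 * x.2 = n := (Nat.mem_divisorsAntidiagonal.1 hx).1
    simp only [hF, hxn]
  rw [hinner, hconv, copInd_apply]
  by_cases hc : n.Coprime q
  · rw [if_pos hc, if_pos ⟨by omega, hc⟩]; ring
  · rw [if_neg hc, if_neg (fun h => hc h.2)]; ring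

/-- The prime number theorem input in uniform form: there are `c₀ > 0` and `C₁ ≥ 0` with
`|m(x)| ≤ C₁ exp(-c₀ √log x)` for all `x ≥ 1` and `|m(x)| ≤ C₁` for all real `x`
(`m(x) = ∑_{e ≤ x} μ(e)/e`): the tree's de la Vallée-Poussin bound for `x ≥ 2`, `m(x) = 1` on
`[1, 2)` and `m(x) = 0` for `x < 1`. [cite: MontgomeryVaughan2007, Section 8.1] -/
theorem exists_abs_sum_moebius_div_le :
    ∃ c₀ : ℝ, 0 < c₀ ∧ ∃ C₁ : ℝ, 0 ≤ C₁ ∧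
      (∀ x : ℝ, 1 ≤ x → |∑ e ∈ Icc 1 ⌊x⌋₊, (μ e : ℝ) / e| ≤
        C₁ * Real.exp (-(c₀ * Real.sqrt (Real.log x)))) ∧
      (∀ x : ℝ, |∑ e ∈ Icc 1 ⌊x⌋₊, (μ e : ℝ) / e| ≤ C₁) := by
  obtain ⟨c₀, hc₀, C₀, hC₀⟩ := abs_sum_moebius_div_le_exp_neg_sqrt_log
  set C₁ : ℝ := max C₀ 0 + Real.exp c₀ with hC₁
  have hC₁0 : 0 ≤ C₁ := by rw [hC₁]; positivity
  have hmain : ∀ x : ℝ, 1 ≤ x → |∑ e ∈ Icc 1 ⌊x⌋₊, (μ e : ℝ) / e| ≤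
      C₁ * Real.exp (-(c₀ * Real.sqrt (Real.log x))) := by
    intro x hx
    have hE0 : 0 < Real.exp (-(c₀ * Real.sqrt (Real.log x))) := Real.exp_pos _
    rcases le_or_gt 2 x with h2 | h2
    · have h := hC₀ x h2
      rw [neg_mul] at h
      refine h.trans (mul_le_mul_of_nonneg_right ?_ hE0.le)
      linarith [le_max_left C₀ 0, Real.exp_pos c₀]
    · -- `1 ≤ x < 2`: the sum is `μ(1)/1 = 1`
      have hfl : ⌊x⌋₊ = 1 := by
        rw [Nat.floor_eq_iff (by linarith)]
        constructor
        · exact_mod_cast hx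
        · push_cast; linarith
      rw [hfl, Finset.Icc_self, Finset.sum_singleton, ArithmeticFunction.moebius_apply_one]
      simp only [Int.cast_one, Nat.cast_one, div_one, abs_one]
      have hlog1 : Real.log x ≤ 1 := by
        have := Real.log_le_sub_one_of_pos (show 0 < x by linarith)
        linarith
      have hsq : Real.sqrt (Real.log x) ≤ 1 := by
        rw [show (1 : ℝ) = Real.sqrt 1 from Real.sqrt_one.symm]
        exact Real.sqrt_le_sqrt hlog1
      have h1 : 1 ≤ Real.exp c₀ * Real.exp (-(c₀ * Real.sqrt (Real.log x))) := by
        rw [← Real.exp_add]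
        refine Real.one_le_exp ?_
        nlinarith
      calc (1 : ℝ) ≤ Real.exp c₀ * Real.exp (-(c₀ * Real.sqrt (Real.log x))) := h1
        _ ≤ C₁ * Real.exp (-(c₀ * Real.sqrt (Real.log x))) := by
          refine mul_le_mul_of_nonneg_right ?_ hE0.le
          linarith [le_max_right C₀ 0]
  refine ⟨c₀, hc₀, C₁, hC₁0, hmain, fun x => ?_⟩
  rcases lt_or_ge x 1 with h1 | h1
  · have hfl : ⌊x⌋₊ = 0 := Nat.floor_eq_zero.2 h1
    have hI : Icc 1 ⌊x⌋₊ = (∅ : Finset ℕ) := by rw [hfl]; decide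
    rw [hI, sum_empty, abs_zero]
    exact hC₁0
  · refine (hmain x h1).trans ?_
    have : Real.exp (-(c₀ * Real.sqrt (Real.log x))) ≤ 1 := by
      rw [Real.exp_le_one_iff]
      have : 0 ≤ c₀ * Real.sqrt (Real.log x) := by positivity
      linarith
    calc C₁ * Real.exp (-(c₀ * Real.sqrt (Real.log x))) ≤ C₁ * 1 :=
        mul_le_mul_of_nonneg_left this hC₁0
      _ = C₁ := mul_one _

/-- **The Rankin factor of `n ≤ R^B` is `R^{o(1)}`**: for `n ≥ 1`, `R ≥ 1`, `B > 0` and `n ≤ R^B`,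
`Π_n(1/2) = ∏_{p ∣ n} (1 - p^{-1/2})⁻¹ ≤ exp(log R/16 + 4) · exp(48 B √log R)`
(`rankinProd_half_le` with `Z = ⌊log R/32⌋ + 1`, and `ω(n) ≤ 2 log n ≤ 2 B log R`). This is the
substitute for GY's (3.5), `|g_k(s)| ≪ exp(4 √log k)` on `σ ≥ -1/4`.
[cite: GoldstonYildirim2001, proof of Lemma 2.1, eq. (3.5)] -/
theorem rankinProd_half_le_of_le_rpow {n : ℕ} (hn : n ≠ 0) {R B : ℝ} (hR : 1 ≤ R) (hB : 0 < B)
    (hnR : (n : ℝ) ≤ R ^ B) :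
    rankinProd (1 / 2) n ≤
      Real.exp (Real.log R / 16 + 4) * Real.exp (48 * B * Real.sqrt (Real.log R)) := by
  set L := Real.log R with hL
  set u := Real.sqrt L with hu
  have hR0 : 0 < R := by linarith
  have hL0 : 0 ≤ L := Real.log_nonneg hR
  have hu0 : 0 ≤ u := Real.sqrt_nonneg _
  have huL : u ^ 2 = L := Real.sq_sqrt hL0
  set Z : ℕ := ⌊L / 32⌋₊ + 1 with hZ
  have hZ1 : 1 ≤ Z := by omega
  have hZle : (Z : ℝ) ≤ L / 32 + 1 := by
    have := Nat.floor_le (div_nonneg hL0 (by norm_num : (0 : ℝ) ≤ 32))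
    rw [hZ]; push_cast; linarith
  have hZge : L / 32 ≤ (Z : ℝ) := by
    have := Nat.lt_floor_add_one (L / 32)
    rw [hZ]; push_cast; linarith
  have hZpos : (0 : ℝ) < Z := by exact_mod_cast hZ1
  have hsZ : 0 < Real.sqrt Z := Real.sqrt_pos.2 hZpos
  -- `u ≤ 6 √Z`
  have husZ : u ≤ 6 * Real.sqrt Z := by
    have h36 : L ≤ (6 * Real.sqrt Z) ^ 2 := by
      rw [mul_pow, Real.sq_sqrt hZpos.le]; linarith
    calc u = Real.sqrt L := hu
      _ ≤ Real.sqrt ((6 * Real.sqrt Z) ^ 2) := Real.sqrt_le_sqrt h36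
      _ = 6 * Real.sqrt Z := Real.sqrt_sq (by positivity)
  -- `ω(n) ≤ 2 B L`: `ω(n) log 2 ≤ log n ≤ B log R` and `log 2 > 1/2` (this is where the
  -- hypothesis `log k ≪ log R` of Lemma 2.1 enters)
  have hω : (n.primeFactors.card : ℝ) ≤ 2 * B * L := by
    have h1 := card_primeFactors_mul_log_two_le hn
    have h2 : Real.log n ≤ B * L := by
      have := Real.log_le_log (by exact_mod_cast Nat.pos_of_ne_zero hn) hnR
      rwa [Real.log_rpow hR0] at this
    have h3 : (1 / 2 : ℝ) < Real.log 2 := by linarith [Real.log_two_gt_d9]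
    have h0 : (0 : ℝ) ≤ n.primeFactors.card := Nat.cast_nonneg _
    nlinarith
  refine (rankinProd_half_le (n := n) hZ1).trans ?_
  refine mul_le_mul ?_ ?_ (by positivity) (by positivity)
  · -- `5^{Z+1} ≤ exp(2(Z+1)) ≤ exp(L/16 + 4)`
    have h5 : (5 : ℝ) ≤ Real.exp 2 := by
      have h := Real.exp_one_gt_d9
      have h2 : Real.exp 2 = Real.exp 1 * Real.exp 1 := by rw [← Real.exp_add]; norm_num
      rw [h2]; nlinarith [Real.exp_pos 1]
    calc (5 : ℝ) ^ (Z + 1) ≤ (Real.exp 2) ^ (Z + 1) := pow_le_pow_left₀ (by norm_num) h5 _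
      _ = Real.exp ((Z + 1 : ℕ) * 2) := (Real.exp_nat_mul 2 (Z + 1)).symm
      _ ≤ Real.exp (L / 16 + 4) := Real.exp_le_exp.2 (by push_cast; linarith)
  · refine Real.exp_le_exp.2 ?_
    rw [div_le_iff₀ hsZ]
    calc 4 * (n.primeFactors.card : ℝ) ≤ 8 * B * u ^ 2 := by rw [huL]; linarith
      _ = (8 * B * u) * u := by ring
      _ ≤ (8 * B * u) * (6 * Real.sqrt Z) := mul_le_mul_of_nonneg_left husZ (by positivity)
      _ = 48 * B * u * Real.sqrt Z := by ring

end GoldstonYildirimLemma21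

open GoldstonYildirimLemma21 in
/-- **Goldston–Yıldırım I, Lemma 2.1, (2.13) at `j = 0` (PROVED).** There is an absolute `c > 0`
such that for every exponent `B > 0` there is `C` with, for all `k ≥ 1`, `R ≥ 1` with `k ≤ R^B`:
`|∑_{d ≤ R, (d,k)=1} μ(d)/d| ≤ C · exp(-c √(log R))`. Discharges
`Literature.NumberTheory.Sieve.goldstonYildirim_lemma21_j0`.
[cite: GoldstonYildirim2001, Lemma 2.1 (2.13) with j = 0] -/
theorem goldstonYildirim_lemma21_j0_holds : goldstonYildirim_lemma21_j0 := by
  obtain ⟨c₀, hc₀, C₁, hC₁, hM1, hM2⟩ := exists_abs_sum_moebius_div_le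
  unfold goldstonYildirim_lemma21_j0
  refine ⟨c₀ / 4, by positivity, fun B hB => ?_⟩
  set K₁ : ℝ := 1 + (24 / (c₀ / 4) ^ 4 + 1) with hK₁
  set K₂ : ℝ := Real.exp 4 * Real.exp (4 / 3 * (48 * B + c₀ / 4) ^ 2) with hK₂
  refine ⟨C₁ * K₁ + C₁ * K₂, fun k hk R hR hkR => ?_⟩
  have hR0 : 0 < R := by linarith
  have hk0 : k ≠ 0 := by omega
  have hL0 : 0 ≤ Real.log R := Real.log_nonneg hR
  set u := Real.sqrt (Real.log R) with hu
  have hu0 : 0 ≤ u := Real.sqrt_nonneg _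
  have huL : u ^ 2 = Real.log R := Real.sq_sqrt hL0
  have hE : Real.exp (-(c₀ / 4) * u) = Real.exp (-(c₀ / 4 * u)) := by rw [neg_mul]
  rw [hE]
  set E := Real.exp (-(c₀ / 4 * u)) with hEdef
  have hE0 : 0 < E := Real.exp_pos _
  -- Step 1: the convolution identity (GY (3.1) on the coefficient side)
  rw [sum_coprime_moebius_div_eq_sum hk0 R]
  set N := ⌊R⌋₊ with hN
  set F := (Icc 1 N).filter (fun m => m.primeFactors ⊆ k.primeFactors) with hF
  -- Step 2: split at `V = √R`
  set V := Real.sqrt R with hV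
  have hV1 : 1 ≤ V := Real.le_sqrt_of_sq_le (by rw [one_pow]; exact hR)
  have hV0 : 0 < V := by linarith
  have hVV : V * V = R := Real.mul_self_sqrt hR0.le
  have hsplit : ∑ m ∈ F, (∑ e ∈ Icc 1 ⌊R / m⌋₊, (μ e : ℝ) / e) / m =
      ∑ m ∈ F.filter (fun m => m ≤ ⌊V⌋₊), (∑ e ∈ Icc 1 ⌊R / m⌋₊, (μ e : ℝ) / e) / m +
      ∑ m ∈ F.filter (fun m => ¬ m ≤ ⌊V⌋₊), (∑ e ∈ Icc 1 ⌊R / m⌋₊, (μ e : ℝ) / e) / m :=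
    (sum_filter_add_sum_filter_not _ _ _).symm
  rw [hsplit]
  refine (abs_add_le _ _).trans ?_
  rw [add_mul]
  refine add_le_add ?_ ?_
  · -- Part 1: `m ≤ √R`, where `R/m ≥ √R` and the de la Vallée-Poussin bound applies
    have hstep : ∀ m ∈ F.filter (fun m => m ≤ ⌊V⌋₊),
        |(∑ e ∈ Icc 1 ⌊R / m⌋₊, (μ e : ℝ) / e) / m| ≤
          C₁ * Real.exp (-(c₀ * (u / 2))) * (1 / m) := by
      intro m hm
      obtain ⟨hmF, hmV⟩ := mem_filter.1 hm
      have hm1 : 1 ≤ m := (mem_Icc.1 (mem_filter.1 hmF).1).1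
      have hm0 : (0 : ℝ) < m := by exact_mod_cast hm1
      have hmV' : (m : ℝ) ≤ V := (Nat.cast_le.2 hmV).trans (Nat.floor_le hV0.le)
      have hRm : V ≤ R / m := by
        rw [le_div_iff₀ hm0]
        calc V * m ≤ V * V := mul_le_mul_of_nonneg_left hmV' hV0.le
          _ = R := hVV
      have hRm1 : 1 ≤ R / m := hV1.trans hRm
      -- `√log(R/m) ≥ u/2`
      have hlog : u / 2 ≤ Real.sqrt (Real.log (R / m)) := by
        refine Real.le_sqrt_of_sq_le ?_
        have h1 : Real.log V ≤ Real.log (R / m) := Real.log_le_log hV0 hRm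
        rw [hV, Real.log_sqrt hR0.le] at h1
        nlinarith [huL, h1, hL0]
      have hb := hM1 (R / m) hRm1
      have hexp : Real.exp (-(c₀ * Real.sqrt (Real.log (R / m)))) ≤
          Real.exp (-(c₀ * (u / 2))) := by
        refine Real.exp_le_exp.2 ?_
        have := mul_le_mul_of_nonneg_left hlog hc₀.le
        linarith
      rw [abs_div, Nat.abs_cast, mul_one_div]
      exact div_le_div_of_nonneg_right (hb.trans (mul_le_mul_of_nonneg_left hexp hC₁)) hm0.le
    refine (abs_sum_le_sum_abs _ _).trans ((sum_le_sum hstep).trans ?_)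
    rw [← mul_sum]
    -- `∑_{m ∈ F, m ≤ √R} 1/m ≤ ∑_{m ≤ N} 1/m ≤ 1 + log R`
    have hharm : ∑ m ∈ F.filter (fun m => m ≤ ⌊V⌋₊), (1 : ℝ) / m ≤ 1 + Real.log R := by
      have hsub : F.filter (fun m => m ≤ ⌊V⌋₊) ⊆ Icc 1 N :=
        (filter_subset _ _).trans (filter_subset _ _)
      refine (sum_le_sum_of_subset_of_nonneg hsub fun m _ _ => by positivity).trans ?_
      have h1 : ∑ m ∈ Icc 1 N, (1 : ℝ) / m = (harmonic N : ℝ) := by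
        rw [harmonic_eq_sum_Icc]
        push_cast
        exact sum_congr rfl fun m _ => one_div _
      rw [h1]
      refine (harmonic_le_one_add_log N).trans ?_
      have hN1 : 1 ≤ N := Nat.le_floor (by exact_mod_cast hR)
      have hN0 : (0 : ℝ) < N := by exact_mod_cast hN1
      have hNR : (N : ℝ) ≤ R := Nat.floor_le hR0.le
      linarith [Real.log_le_log hN0 hNR]
    -- `(1 + log R) e^{-c₀ u/2} ≤ K₁ e^{-c₀ u/4}`
    have hsplitexp : Real.exp (-(c₀ * (u / 2))) = E * E := by
      rw [hEdef, ← Real.exp_add]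
      congr 1
      ring
    have hK : (1 + Real.log R) * E ≤ K₁ := by
      have h1 : E ≤ 1 := by
        rw [hEdef, Real.exp_le_one_iff]
        have : 0 ≤ c₀ / 4 * u := by positivity
        linarith
      have h2 : Real.log R * E ≤ 24 / (c₀ / 4) ^ 4 + 1 := by
        rw [hEdef, hu]
        exact log_mul_exp_neg_mul_sqrt_le (a := c₀ / 4) (by positivity) hR
      rw [hK₁]
      linarith
    calc C₁ * Real.exp (-(c₀ * (u / 2))) * ∑ m ∈ F.filter (fun m => m ≤ ⌊V⌋₊), (1 : ℝ) / m
        ≤ C₁ * Real.exp (-(c₀ * (u / 2))) * (1 + Real.log R) :=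
          mul_le_mul_of_nonneg_left hharm (by positivity)
      _ = C₁ * ((1 + Real.log R) * E) * E := by rw [hsplitexp]; ring
      _ ≤ C₁ * K₁ * E :=
          mul_le_mul_of_nonneg_right (mul_le_mul_of_nonneg_left hK hC₁) hE0.le
  · -- Part 2: `m > √R`, the trivial bound on `m(R/m)` and Rankin's trick
    have hstep : ∀ m ∈ F.filter (fun m => ¬ m ≤ ⌊V⌋₊),
        |(∑ e ∈ Icc 1 ⌊R / m⌋₊, (μ e : ℝ) / e) / m| ≤ C₁ * (1 / m) := by
      intro m hm
      have hm1 : 1 ≤ m := (mem_Icc.1 (mem_filter.1 (mem_filter.1 hm).1).1).1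
      have hm0 : (0 : ℝ) < m := by exact_mod_cast hm1
      rw [abs_div, Nat.abs_cast, mul_one_div]
      exact div_le_div_of_nonneg_right (hM2 _) hm0.le
    refine (abs_sum_le_sum_abs _ _).trans ((sum_le_sum hstep).trans ?_)
    rw [← mul_sum]
    -- the tail is a sum over `Ioc ⌊V⌋₊ N`
    have hFeq : F.filter (fun m => ¬ m ≤ ⌊V⌋₊) =
        (Ioc ⌊V⌋₊ N).filter (fun m => m.primeFactors ⊆ k.primeFactors) := by
      ext m
      simp only [hF, mem_filter, mem_Icc, mem_Ioc, not_le]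
      constructor
      · rintro ⟨⟨⟨-, h2⟩, h3⟩, h4⟩
        exact ⟨⟨h4, h2⟩, h3⟩
      · rintro ⟨⟨h4, h2⟩, h3⟩
        exact ⟨⟨⟨by omega, h2⟩, h3⟩, h4⟩
    have htail : ∑ m ∈ F.filter (fun m => ¬ m ≤ ⌊V⌋₊), (1 : ℝ) / m ≤
        V ^ (-(1 / 2 : ℝ)) * rankinProd (1 / 2) k := by
      rw [hFeq]
      exact sum_radInd_div_Ioc_le hk0 hV1 N
    -- `V^{-1/2} = R^{-1/4} = exp(-log R / 4)`
    have hVexp : V ^ (-(1 / 2 : ℝ)) = Real.exp (-(Real.log R / 4)) := by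
      rw [hV, Real.sqrt_eq_rpow, ← Real.rpow_mul hR0.le, Real.rpow_def_of_pos hR0]
      congr 1
      ring
    have hPi : rankinProd (1 / 2) k ≤
        Real.exp (Real.log R / 16 + 4) * Real.exp (48 * B * u) := by
      rw [hu]
      exact rankinProd_half_le_of_le_rpow hk0 hR hB hkR
    -- the exponent: `-L/4 + L/16 + 4 + 48 B u ≤ 4 + (4/3)(48 B + c₀/4)² - (c₀/4) u`
    have hquad : -(Real.log R / 4) + (Real.log R / 16 + 4) + 48 * B * u ≤
        4 + 4 / 3 * (48 * B + c₀ / 4) ^ 2 + -(c₀ / 4 * u) := by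
      rw [← huL]
      nlinarith [sq_nonneg (u - 8 * (48 * B + c₀ / 4) / 3)]
    have hprod : V ^ (-(1 / 2 : ℝ)) * rankinProd (1 / 2) k ≤ K₂ * E := by
      calc V ^ (-(1 / 2 : ℝ)) * rankinProd (1 / 2) k
          ≤ Real.exp (-(Real.log R / 4)) *
              (Real.exp (Real.log R / 16 + 4) * Real.exp (48 * B * u)) := by
            rw [hVexp]
            exact mul_le_mul_of_nonneg_left hPi (Real.exp_pos _).le
        _ = Real.exp (-(Real.log R / 4) + (Real.log R / 16 + 4) + 48 * B * u) := by
            rw [← Real.exp_add, ← Real.exp_add]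
            congr 1
            ring
        _ ≤ Real.exp (4 + 4 / 3 * (48 * B + c₀ / 4) ^ 2 + -(c₀ / 4 * u)) :=
            Real.exp_le_exp.2 hquad
        _ = K₂ * E := by rw [hK₂, hEdef, Real.exp_add, Real.exp_add]
    calc C₁ * ∑ m ∈ F.filter (fun m => ¬ m ≤ ⌊V⌋₊), (1 : ℝ) / m
        ≤ C₁ * (V ^ (-(1 / 2 : ℝ)) * rankinProd (1 / 2) k) := mul_le_mul_of_nonneg_left htail hC₁
      _ ≤ C₁ * (K₂ * E) := mul_le_mul_of_nonneg_left hprod hC₁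
      _ = C₁ * K₂ * E := by ring

end Literature.NumberTheory.Sieve
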